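import Literature.Probability.Percolation.QuadCrossingContinuityReduction
import HarnessLib

/-!
# The flipped quad `(s, t) ↦ Q(s, 1 - t)`: exchanging `∂₁` and `∂₃`

Topic `Probability/Percolation`; proofs file towards the named fact `SchrammSmirnov2011_lemma_6_1`
(`QuadCrossingContinuity.lean`; O. Schramm, S. Smirnov, *On the scaling limits of planar
percolation*, Ann. Probab. 39 (2011), arXiv:1101.5820, proof of Lemma 6.1: "We will work with
configurations with a crossing landing on `σ₃`, the other case being symmetric").

The symmetry is the reflection of the parameter square in the horizontal midline: `Quad.flip Q`
is `(s, t) ↦ Q(s, 1 - t)`.  It has the same carrier and the same sides `∂₀`, `∂₂`, exchanges `∂₁`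
and `∂₃`, hence has the same crossings, crossing events, side distances and size parameter, and
condition (2) of Lemma 6.1 passes to the flipped pair.  (The "uppermost crossing" of `Q'` is the
lowest crossing of `Q'.flip`.)  Everything is proved.

## References

* O. Schramm, S. Smirnov, Ann. Probab. 39 (2011) 1768–1814, arXiv:1101.5820, proof of Lemma 6.1.
  [SchrammSmirnov2011]
-/

noncomputable section

open scoped unitInterval
open Set Metric Function
open Literature.Probability.LatticeModels

namespace Literature.Probability.Percolation

namespace QuadCrossing

namespace Quad

variable {D : Set ℂ}

/-- **The flipped quad** `(s, t) ↦ Q(s, 1 - t)`. [cite: SchrammSmirnov2011, proof of Lemma 6.1] -/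
def flip (Q : Quad D) : Quad D where
  toFun p := Q (p.1, σ p.2)
  continuous_toFun := Q.continuous_toFun.comp (continuous_fst.prodMk
    (unitInterval.continuous_symm.comp continuous_snd))
  injective_toFun p q h := by
    have := Q.injective_toFun h
    simp only [Prod.mk.injEq, unitInterval.symm_inj] at this
    exact Prod.ext this.1 this.2
  range_subset := by
    rintro _ ⟨p, rfl⟩
    exact Q.range_subset ⟨(p.1, σ p.2), rfl⟩

/-- `flip_apply`: structural lemma for the definition above. [folklore] -/
@[simp] theorem flip_apply (Q : Quad D) (p : I × I) : Q.flip p = Q (p.1, σ p.2) := rfl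

/-- The flipped quad has the same carrier. [folklore] -/
@[simp] theorem flip_carrier (Q : Quad D) : Q.flip.carrier = Q.carrier := by
  refine subset_antisymm ?_ ?_
  · rintro _ ⟨p, rfl⟩; exact ⟨(p.1, σ p.2), rfl⟩
  · rintro _ ⟨p, rfl⟩
    refine ⟨(p.1, σ p.2), ?_⟩
    show Q (p.1, σ (σ p.2)) = Q p
    rw [unitInterval.symm_symm]

/-- `∂₀` is unchanged. [folklore] -/
@[simp] theorem flip_side_zero (Q : Quad D) : Q.flip.side 0 = Q.side 0 := by
  refine subset_antisymm ?_ ?_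
  · rintro _ ⟨p, hp, rfl⟩; exact ⟨(p.1, σ p.2), hp, rfl⟩
  · rintro _ ⟨p, hp, rfl⟩
    refine ⟨(p.1, σ p.2), hp, ?_⟩
    show Q (p.1, σ (σ p.2)) = Q p
    rw [unitInterval.symm_symm]

/-- `∂₂` is unchanged. [folklore] -/
@[simp] theorem flip_side_two (Q : Quad D) : Q.flip.side 2 = Q.side 2 := by
  refine subset_antisymm ?_ ?_
  · rintro _ ⟨p, hp, rfl⟩; exact ⟨(p.1, σ p.2), hp, rfl⟩
  · rintro _ ⟨p, hp, rfl⟩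
    refine ⟨(p.1, σ p.2), hp, ?_⟩
    show Q (p.1, σ (σ p.2)) = Q p
    rw [unitInterval.symm_symm]

/-- `∂₁` of the flipped quad is `∂₃`. [folklore] -/
@[simp] theorem flip_side_one (Q : Quad D) : Q.flip.side 1 = Q.side 3 := by
  refine subset_antisymm ?_ ?_
  · rintro _ ⟨p, hp, rfl⟩
    refine ⟨(p.1, σ p.2), ?_, rfl⟩
    show σ p.2 = 1
    rw [show p.2 = 0 from hp, unitInterval.symm_zero]
  · rintro _ ⟨p, hp, rfl⟩
    refine ⟨(p.1, σ p.2), ?_, ?_⟩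
    · show σ p.2 = 0
      rw [show p.2 = 1 from hp, unitInterval.symm_one]
    · show Q (p.1, σ (σ p.2)) = Q p
      rw [unitInterval.symm_symm]

/-- `∂₃` of the flipped quad is `∂₁`. [folklore] -/
@[simp] theorem flip_side_three (Q : Quad D) : Q.flip.side 3 = Q.side 1 := by
  refine subset_antisymm ?_ ?_
  · rintro _ ⟨p, hp, rfl⟩
    refine ⟨(p.1, σ p.2), ?_, rfl⟩
    show σ p.2 = 0
    rw [show p.2 = 1 from hp, unitInterval.symm_one]
  · rintro _ ⟨p, hp, rfl⟩
    refine ⟨(p.1, σ p.2), ?_, ?_⟩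
    · show σ p.2 = 1
      rw [show p.2 = 0 from hp, unitInterval.symm_zero]
    · show Q (p.1, σ (σ p.2)) = Q p
      rw [unitInterval.symm_symm]

/-- Crossings are unchanged. [folklore] -/
theorem flip_isCrossing_iff (Q : Quad D) (K : Set ℂ) : Q.flip.IsCrossing K ↔ Q.IsCrossing K := by
  simp only [IsCrossing, flip_carrier, flip_side_zero, flip_side_two]

/-- The "crossed inside the open edges" event is unchanged. [folklore] -/
theorem flip_exists_isCrossing_iff (Q : Quad D) (O : Set ℂ) :
    (∃ K, Q.flip.IsCrossing K ∧ K ⊆ O) ↔ ∃ K, Q.IsCrossing K ∧ K ⊆ O := by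
  simp only [flip_isCrossing_iff]

/-- The side distances `d₀` agree. [folklore] -/
theorem flip_sideDist_zero (Q : Quad D) : Q.flip.sideDist 0 = Q.sideDist 0 := by
  simp only [sideDist, flip_carrier, flip_side_zero, show ((0 : Fin 4) + 2) = 2 from rfl,
    flip_side_two]

/-- The side distances `d₁` agree (paths reversed). [folklore] -/
theorem flip_sideDist_one (Q : Quad D) : Q.flip.sideDist 1 = Q.sideDist 1 := by
  simp only [sideDist, flip_carrier, flip_side_one, show ((1 : Fin 4) + 2) = 3 from rfl,
    flip_side_three]
  congr 1
  ext r
  constructor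
  · rintro ⟨x, hx, y, hy, γ, hγ, hr⟩
    exact ⟨y, hy, x, hx, γ.symm, by rwa [Path.symm_range], by rwa [Path.symm_range]⟩
  · rintro ⟨x, hx, y, hy, γ, hγ, hr⟩
    exact ⟨y, hy, x, hx, γ.symm, by rwa [Path.symm_range], by rwa [Path.symm_range]⟩

/-- The size parameters agree. [folklore] -/
theorem flip_sizeParam (Q : Quad D) : Q.flip.sizeParam = Q.sizeParam := by
  simp only [sizeParam, flip_sideDist_zero, flip_sideDist_one]

/-- Short junctions are unchanged (same carrier). [folklore] -/
theorem flip_shortJoin_iff (Q : Quad D) (δ : ℝ) (x : ℂ) (T : Set ℂ) :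
    Q.flip.ShortJoin δ x T ↔ Q.ShortJoin δ x T := by
  simp only [ShortJoin, flip_carrier]

/-- **Condition (2) passes to the flipped pair.** [cite: SchrammSmirnov2011, Lemma 6.1 (2)] -/
theorem IsPerturbationTwo.flip {Q Q' : Quad D} {δ : ℝ} (h : Q.IsPerturbationTwo Q' δ) :
    Q.flip.IsPerturbationTwo Q'.flip δ := by
  obtain ⟨hcar, h0, h1, h3, hjoin⟩ := h
  refine ⟨by simpa using hcar, by simpa using h0, by simpa using h3, by simpa using h1, ?_⟩
  intro x hx
  rw [flip_side_two] at hx ⊢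
  rw [flip_shortJoin_iff]
  exact hjoin x hx

/-- The free side of the flipped quad, pointwise. [folklore] -/
theorem flip_apply_one (Q : Quad D) (t : I) : Q.flip (1, t) = Q (1, σ t) := rfl

/-- **The sub-arc regularity of `∂₂` passes to the flipped quad.** [folklore] -/
theorem flip_arc {Q : Quad D} {ρ K : ℝ}
    (harc : ∀ s t : I, dist (Q (1, s)) (Q (1, t)) ≤ ρ → ∀ u : I,
      ((s : ℝ) ≤ u ∧ (u : ℝ) ≤ t ∨ (t : ℝ) ≤ u ∧ (u : ℝ) ≤ s) → dist (Q (1, u)) (Q (1, s)) ≤ K * ρ) :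
    ∀ s t : I, dist (Q.flip (1, s)) (Q.flip (1, t)) ≤ ρ → ∀ u : I,
      ((s : ℝ) ≤ u ∧ (u : ℝ) ≤ t ∨ (t : ℝ) ≤ u ∧ (u : ℝ) ≤ s) →
        dist (Q.flip (1, u)) (Q.flip (1, s)) ≤ K * ρ := by
  intro s t hst u hu
  simp only [flip_apply_one] at hst ⊢
  refine harc (σ s) (σ t) hst (σ u) ?_
  simp only [unitInterval.coe_symm_eq]
  rcases hu with ⟨h1, h2⟩ | ⟨h1, h2⟩
  · exact Or.inr ⟨by linarith, by linarith⟩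
  · exact Or.inl ⟨by linarith, by linarith⟩

end Quad

end QuadCrossing

end Literature.Probability.Percolation
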